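import Summits.HodgeConjecture.CorCM.GaloisSkewSectionPrime
import Summits.HodgeConjecture.CorCM.GaloisSkewCountPrime
import Summits.HodgeConjecture.CorCM.GaloisRightStabiliserDegenerate
import HarnessLib

/-!
# A NON-NORMAL SUBGROUP OF PRIME ORDER IN THE GALOIS GROUP MAKES A LARGE GALOIS CM FIELD BAD: in GOOD Galois CM fields of
# large degree every subgroup of prime order of the Galois group is normal

COR-CM (cell `pub-hodgecm2`), binder seat b04 (gen 33), count-neutral own lane «Galois-CM-type classification».  KERNEL ONLY:
theorems; no definition, no named fact, no `sorry`.  `HC_CM` is neither used nor claimed.  Assembly of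
`CorCM/GaloisSkewSectionPrime.exists_skew_of_nonnormal_prime_order` (gen 33: a central involution `c`, an element `u` of prime
order `p` generating a NON-NORMAL subgroup, and the count `|G|·2^(n/2) + m(p-1)·2^((n+n/m)/2) < 2^n` (`|G| = 2pn`, all `m ≥ 2`
dividing `n`) ⟹ a CM set with trivial LEFT and non-trivial RIGHT stabiliser), the clean size conditions of
`CorCM/GaloisSkewCountPrime`, and gen 23's `GaloisModels.exists_simple_degenerate_of_model_skew` (a skew CM set is read by a
PRIMITIVE DEGENERATE CM type: its reflex field is a proper subfield — Shimura §32.10 — while §8.2 Prop. 26 makes the abelian variety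
simple).  The case `p = 2` (a non-central involution, `[K:ℚ] ≥ 64`) is gen 32's `CorCM/GaloisNonCentralInvolution`.

* **`exists_simple_degenerate_of_nonnormal_prime_order`** — model form with the raw count: `e : Gal(K/ℚ) ≃* G₀`, `|G₀| = 2pn`,
  `u ∈ G₀` with `uᵖ = 1 ≠ u` and `g u g⁻¹ ∉ ⟨u⟩` for some `g` ⟹ `K` carries a SIMPLE DEGENERATE abelian variety of dimension
  `|G₀|/2` with CM by `K` (an exceptional Hodge class on some power).
* **`exists_simple_degenerate_of_prime_order_family`** — the family form (`m₀` exhibited conjugates, count for `m ≥ m₀` only).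
* **`exists_simple_degenerate_of_nonnormal_prime_order_of_le`** — the same from `16 ≤ n` and `8p ≤ 2^(n/4)` (any prime `p`).
* **`exists_simple_degenerate_of_nonnormal_order_three`** — `p = 3`: `|G₀| ≥ 84` suffices.
* **`exists_simple_degenerate_of_noncentral_involution_of_card_ge`** — `p = 2`: a non-central involution and `|G₀| ≥ 52` (gen 32's
  theorem had `64`; the refined fibre count closes `52, 56, 60`); **`exists_simple_degenerate_of_involution_three_conjugates`** —
  `|G₀| = 48` and an involution with at least three conjugates (`GL(2,3)`, `A₄ × C₄`, `SL(2,3)∘C₄`, …).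
* **`…_gal`** forms on `Gal(K/ℚ)` itself, and the contrapositives **`exists_conj_eq_pow_of_forall_isNondegenerate`** (`[K:ℚ] = 2pn`,
  `16 ≤ n`, `8p ≤ 2^(n/4)`) and **`exists_conj_eq_pow_three_of_forall_isNondegenerate`** (`[K:ℚ] ≥ 84`): if every primitive CM
  type of `K` is nondegenerate — the Hodge ring of every power of every simple abelian variety with CM by `K` is generated by
  divisor classes — then EVERY SUBGROUP OF PRIME ORDER `p` (resp. `3`) OF `Gal(K/ℚ)` IS NORMAL.
* **`commute_of_prime_order_of_forall_isNondegenerate`**, **`commute_of_prime_orders_…`**, **`commute_of_order_three_…`** — hence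
  in a GOOD field the elements of prime order of `Gal(K/ℚ)` COMMUTE pairwise (same or different primes, size conditions for each;
  `[K:ℚ] ≥ 84` for order `3`; involutions: `[K:ℚ] ≥ 52`): two normal subgroups of prime order normalise each other only by commuting.
CONSEQUENCES for the seat's classification (A7-JUNCTION gen-33 addendum): with gen 32 (all involutions central) and monotonicity
(`CorCM/GaloisDegenerateMonotone`), a GOOD pair `(G, c)` of large order has ALL its minimal subgroups normal and the subgroup they
generate is ABELIAN (a product of elementary abelian groups on which `G` acts by power automorphisms); rows settled by this file alone:
`SL(2,3) × C₄` and `A₄ × C₈` for EVERY complex conjugation (order `96`, `p = 3`), `(C₇ ⋊ C₃) × C₄` (`84`), the binary icosahedral `SL(2,5)` (order `120`; a perfect group — no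
imaginary quadratic subfield, no index-two machinery applies), `SL(2,3) × C_{2^k}` (`k ≥ 2`), every `H × Γ` with a non-normal
subgroup of order `3` in `H` once `|G| ≥ 96`, … (instances in `CorCM/GaloisNonNormalPrimeOrderInstances`).
«BAD» = a primitive degenerate CM type = an exceptional Hodge class on a power of a simple CM abelian variety (algebraicity open);
«GOOD» = `B = D` on all powers of all simple CM abelian varieties with CM by the field.

## References

* [Shimura1998] G. Shimura, *Abelian Varieties with Complex Multiplication and Modular Functions*, §6.2 Thm. 3, §8.2 Prop. 26, §32.10.
* [Gordon1999HodgeAVSurvey] B. B. Gordon, *A survey of the Hodge conjecture for abelian varieties*, Thm. 6.4, §9.3.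
* [Kubota1965] T. Kubota, *On the field extension by complex multiplication*, Trans. AMS 118 (1965), §2.
-/

noncomputable section

open CategoryTheory CategoryTheory.Limits NumberField
open scoped BigOperators

namespace Summit.HodgeConjecture.CorCM.GaloisModels

open Literature.NumberTheory.ComplexMultiplication
open Literature.AlgebraicGeometry.Motives (AbelianVariety CMType)
open Literature.AlgebraicGeometry.HodgeTheory
open Literature.AlgebraicGeometry.ComplexMultiplication (IsCMTypeRealisation)
open Literature.AlgebraicGeometry.Pohlmann1968
open Literature.Barriers.HodgeConjecture (divisorClassesSpan)
open Summit.HodgeConjecture.CorCM.GaloisRank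

variable {K : Type} [Field K] [NumberField K] [IsCMField K] [IsGalois ℚ K]

/-- **A NON-NORMAL SUBGROUP OF PRIME ORDER MAKES THE FIELD BAD** (model form, raw count): `e : Gal(K/ℚ) ≃* G₀`, `|G₀| = 2pn`,
`uᵖ = 1 ≠ u`, `g u g⁻¹ ∉ ⟨u⟩` for some `g`, and `2pn·2^(n/2) + m(p-1)·2^((n+n/m)/2) < 2^n` for all `m ≥ 2` dividing `n` ⟹ `K`
carries a SIMPLE DEGENERATE abelian variety of dimension `|G₀|/2` with CM by `K` and a rational `(q,q)` class outside the divisor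
ring on some power. [cite: Shimura1998, §6.2 Thm. 3, §8.2 Prop. 26 and §32.10] [cite: Gordon1999HodgeAVSurvey, Thm. 6.4 and §9.3] -/
theorem exists_simple_degenerate_of_nonnormal_prime_order {G₀ : Type*} [Group G₀] [Fintype G₀] [DecidableEq G₀]
    (e : (K ≃ₐ[ℚ] K) ≃* G₀) (u : G₀) (p n : ℕ) [Fact p.Prime] (hup : u ^ p = 1) (hu1 : u ≠ 1)
    (hcard : Fintype.card G₀ = 2 * p * n) (hnn : ∃ g : G₀, ∀ k < p, g * u * g⁻¹ ≠ u ^ k)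
    (hcount : ∀ m, 2 ≤ m → m ∣ n → 2 * p * n * 2 ^ (n / 2) + m * (p - 1) * 2 ^ ((n + n / m) / 2) < 2 ^ n) :
    ∃ (Φ : CMType K) (φ₀ : K →+* ℂ) (A : AbelianVariety ℂ) (ι : 𝓞 K →+* End A)
      (θ : K →+* Module.End ℂ (complexBetti A.X 1)),
      IsPrimitive (ℂ ≃+* ℂ) Φ.1 φ₀ ∧ ¬ IsNondegenerate Φ ∧ IsCMTypeRealisation Φ A ι θ ∧ A.IsSimple ∧
      A.dim = Fintype.card G₀ / 2 ∧
      ∃ n p : ℕ, ∃ x : complexBetti (⨁ fun _ : Fin n => A).X (2 * p), IsRationalClass x ∧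
        IsOfHodgeType (⨁ fun _ : Fin n => A).dim (⨁ fun _ : Fin n => A).X (2 * p) p p x ∧
        x ∉ divisorClassesSpan (⨁ fun _ : Fin n => A).X (⨁ fun _ : Fin n => A).dim p := by
  classical
  set c := e ((IsCMField.complexConj K).restrictScalars ℚ) with hc_def
  have hcc : c * c = 1 := model_complexConj_mul_self e rfl
  have hc1 : c ≠ 1 := model_complexConj_ne_one e rfl
  have hcen : ∀ g : G₀, c * g = g * c := model_complexConj_comm e rfl
  obtain ⟨T, hcm, hprim, hTu⟩ := SkewSectionPrime.exists_skew_of_nonnormal_prime_order c u p n hcc hc1 hcen hup hu1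
    hcard hnn (by rw [hcard]; exact hcount)
  exact exists_simple_degenerate_of_model_skew e c rfl T hcm hprim hu1 hTu

/-- **… FAMILY form** (below the generic thresholds): with `m₀` exhibited conjugators `g_i` of `⟨u⟩` (`g_j⁻¹ g_i ∉ N(⟨u⟩)` for
`i < j`), the hypothesis `c ∉ ⟨u⟩` on the model's complex conjugation, and the count only for `m ≥ m₀` dividing `n`.  (Example:
`GL(2,3)`, `p = 2`, `n = 12`, `m₀ = 3` — order `48`, below gen 32's `64`: `CorCM/GaloisGeneralLinearTwoThreeDegenerate`.)
[cite: Shimura1998, §6.2 Thm. 3, §8.2 Prop. 26 and §32.10] [cite: Gordon1999HodgeAVSurvey, Thm. 6.4 and §9.3] -/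
theorem exists_simple_degenerate_of_prime_order_family {G₀ : Type*} [Group G₀] [Fintype G₀] [DecidableEq G₀]
    (e : (K ≃ₐ[ℚ] K) ≃* G₀) (u : G₀) (p n m₀ : ℕ) [Fact p.Prime] (hup : u ^ p = 1) (hu1 : u ≠ 1)
    (hcU : ∀ j < p, e ((IsCMField.complexConj K).restrictScalars ℚ) ≠ u ^ j)
    (hcard : Fintype.card G₀ = 2 * p * n) (g : Fin m₀ → G₀)
    (hind : ∀ i j : Fin m₀, i < j → ∀ k < p, ((g j)⁻¹ * g i) * u * ((g j)⁻¹ * g i)⁻¹ ≠ u ^ k)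
    (hcount : ∀ m, m₀ ≤ m → m ∣ n → 2 * p * n * 2 ^ (n / 2) + m * (p - 1) * 2 ^ ((n + n / m) / 2) < 2 ^ n) :
    ∃ (Φ : CMType K) (φ₀ : K →+* ℂ) (A : AbelianVariety ℂ) (ι : 𝓞 K →+* End A)
      (θ : K →+* Module.End ℂ (complexBetti A.X 1)),
      IsPrimitive (ℂ ≃+* ℂ) Φ.1 φ₀ ∧ ¬ IsNondegenerate Φ ∧ IsCMTypeRealisation Φ A ι θ ∧ A.IsSimple ∧
      A.dim = Fintype.card G₀ / 2 ∧
      ∃ n p : ℕ, ∃ x : complexBetti (⨁ fun _ : Fin n => A).X (2 * p), IsRationalClass x ∧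
        IsOfHodgeType (⨁ fun _ : Fin n => A).dim (⨁ fun _ : Fin n => A).X (2 * p) p p x ∧
        x ∉ divisorClassesSpan (⨁ fun _ : Fin n => A).X (⨁ fun _ : Fin n => A).dim p := by
  classical
  set c := e ((IsCMField.complexConj K).restrictScalars ℚ) with hc_def
  have hcc : c * c = 1 := model_complexConj_mul_self e rfl
  have hcen : ∀ g : G₀, c * g = g * c := model_complexConj_comm e rfl
  obtain ⟨T, hcm, hprim, hTu⟩ := SkewSectionPrime.exists_skew_of_prime_order_family c u p n m₀ hcc hcen hup hu1 hcU hcard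
    g hind (by rw [hcard]; exact hcount)
  exact exists_simple_degenerate_of_model_skew e c rfl T hcm hprim hu1 hTu

/-- **… from the clean size condition** `16 ≤ n`, `8p ≤ 2^(n/4)` (`|G₀| = 2pn`; any prime `p`).
[cite: Shimura1998, §6.2 Thm. 3, §8.2 Prop. 26 and §32.10] [cite: Gordon1999HodgeAVSurvey, Thm. 6.4 and §9.3] -/
theorem exists_simple_degenerate_of_nonnormal_prime_order_of_le {G₀ : Type*} [Group G₀] [Fintype G₀] [DecidableEq G₀]
    (e : (K ≃ₐ[ℚ] K) ≃* G₀) (u : G₀) (p n : ℕ) [hp : Fact p.Prime] (hup : u ^ p = 1) (hu1 : u ≠ 1)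
    (hcard : Fintype.card G₀ = 2 * p * n) (hnn : ∃ g : G₀, ∀ k < p, g * u * g⁻¹ ≠ u ^ k)
    (hn : 16 ≤ n) (hpn : 8 * p ≤ 2 ^ (n / 4)) :
    ∃ (Φ : CMType K) (φ₀ : K →+* ℂ) (A : AbelianVariety ℂ) (ι : 𝓞 K →+* End A)
      (θ : K →+* Module.End ℂ (complexBetti A.X 1)),
      IsPrimitive (ℂ ≃+* ℂ) Φ.1 φ₀ ∧ ¬ IsNondegenerate Φ ∧ IsCMTypeRealisation Φ A ι θ ∧ A.IsSimple ∧
      A.dim = Fintype.card G₀ / 2 ∧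
      ∃ n p : ℕ, ∃ x : complexBetti (⨁ fun _ : Fin n => A).X (2 * p), IsRationalClass x ∧
        IsOfHodgeType (⨁ fun _ : Fin n => A).dim (⨁ fun _ : Fin n => A).X (2 * p) p p x ∧
        x ∉ divisorClassesSpan (⨁ fun _ : Fin n => A).X (⨁ fun _ : Fin n => A).dim p :=
  exists_simple_degenerate_of_nonnormal_prime_order e u p n hup hu1 hcard hnn
    (SkewSectionPrime.count_of_le_two_pow p n hp.out.two_le hn hpn)

/-- **… for `p = 3`: `|G₀| ≥ 84` suffices** (`u³ = 1 ≠ u`, `⟨u⟩` not normal).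
[cite: Shimura1998, §6.2 Thm. 3, §8.2 Prop. 26 and §32.10] [cite: Gordon1999HodgeAVSurvey, Thm. 6.4 and §9.3] -/
theorem exists_simple_degenerate_of_nonnormal_order_three {G₀ : Type*} [Group G₀] [Fintype G₀] [DecidableEq G₀]
    (e : (K ≃ₐ[ℚ] K) ≃* G₀) (u : G₀) (hu3 : u ^ 3 = 1) (hu1 : u ≠ 1) (hnn : ∃ g : G₀, ∀ k < 3, g * u * g⁻¹ ≠ u ^ k)
    (hbig : 84 ≤ Fintype.card G₀) :
    ∃ (Φ : CMType K) (φ₀ : K →+* ℂ) (A : AbelianVariety ℂ) (ι : 𝓞 K →+* End A)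
      (θ : K →+* Module.End ℂ (complexBetti A.X 1)),
      IsPrimitive (ℂ ≃+* ℂ) Φ.1 φ₀ ∧ ¬ IsNondegenerate Φ ∧ IsCMTypeRealisation Φ A ι θ ∧ A.IsSimple ∧
      A.dim = Fintype.card G₀ / 2 ∧
      ∃ n p : ℕ, ∃ x : complexBetti (⨁ fun _ : Fin n => A).X (2 * p), IsRationalClass x ∧
        IsOfHodgeType (⨁ fun _ : Fin n => A).dim (⨁ fun _ : Fin n => A).X (2 * p) p p x ∧
        x ∉ divisorClassesSpan (⨁ fun _ : Fin n => A).X (⨁ fun _ : Fin n => A).dim p := by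
  classical
  haveI : Fact (Nat.Prime 3) := ⟨Nat.prime_three⟩
  set c := e ((IsCMField.complexConj K).restrictScalars ℚ) with hc_def
  have hcc : c * c = 1 := model_complexConj_mul_self e rfl
  have hc1 : c ≠ 1 := model_complexConj_ne_one e rfl
  have hcen : ∀ g : G₀, c * g = g * c := model_complexConj_comm e rfl
  obtain ⟨n, hn⟩ := SkewSectionPrime.two_mul_prime_dvd_card c u 3 hcc hu3 hu1 (hcen u)
    (SkewSectionPrime.ne_pow_of_nonnormal hc1 hcen hu3 hu1 hnn)
  exact exists_simple_degenerate_of_nonnormal_prime_order e u 3 n hu3 hu1 hn hnn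
    (SkewSectionPrime.count_three_of_fourteen_le n (by omega))

/-- **`p = 2`: a NON-CENTRAL INVOLUTION and `|G₀| ≥ 52`** ⟹ a simple DEGENERATE abelian variety of dimension `|G₀|/2` with CM by
`K` (gen 32's `exists_simple_degenerate_of_noncentral_involution` needed `64`; the fibre count by the number of conjugates closes the
orders `52, 56, 60` — at `48` it fails exactly when the involution has only two conjugates).
[cite: Shimura1998, §6.2 Thm. 3, §8.2 Prop. 26 and §32.10] [cite: Gordon1999HodgeAVSurvey, Thm. 6.4 and §9.3] -/
theorem exists_simple_degenerate_of_noncentral_involution_of_card_ge {G₀ : Type*} [Group G₀] [Fintype G₀] [DecidableEq G₀]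
    (e : (K ≃ₐ[ℚ] K) ≃* G₀) (u : G₀) (huu : u * u = 1) (hnc : ∃ g : G₀, g * u ≠ u * g) (hbig : 52 ≤ Fintype.card G₀) :
    ∃ (Φ : CMType K) (φ₀ : K →+* ℂ) (A : AbelianVariety ℂ) (ι : 𝓞 K →+* End A)
      (θ : K →+* Module.End ℂ (complexBetti A.X 1)),
      IsPrimitive (ℂ ≃+* ℂ) Φ.1 φ₀ ∧ ¬ IsNondegenerate Φ ∧ IsCMTypeRealisation Φ A ι θ ∧ A.IsSimple ∧
      A.dim = Fintype.card G₀ / 2 ∧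
      ∃ n p : ℕ, ∃ x : complexBetti (⨁ fun _ : Fin n => A).X (2 * p), IsRationalClass x ∧
        IsOfHodgeType (⨁ fun _ : Fin n => A).dim (⨁ fun _ : Fin n => A).X (2 * p) p p x ∧
        x ∉ divisorClassesSpan (⨁ fun _ : Fin n => A).X (⨁ fun _ : Fin n => A).dim p := by
  classical
  set c := e ((IsCMField.complexConj K).restrictScalars ℚ) with hc_def
  have hcc : c * c = 1 := model_complexConj_mul_self e rfl
  have hc1 : c ≠ 1 := model_complexConj_ne_one e rfl
  have hcen : ∀ g : G₀, c * g = g * c := model_complexConj_comm e rfl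
  obtain ⟨g, hg⟩ := hnc
  have hu1 : u ≠ 1 := fun h => hg (by rw [h, mul_one, one_mul])
  have hu2 : u ^ 2 = 1 := by rw [pow_two, huu]
  have hnn : ∃ g : G₀, ∀ k < 2, g * u * g⁻¹ ≠ u ^ k := by
    refine ⟨g, fun k hk h => ?_⟩
    interval_cases k
    · rw [pow_zero] at h
      exact hu1 (by have := congrArg (fun x => g⁻¹ * x * g) h; simpa [mul_assoc] using this)
    · rw [pow_one] at h
      exact hg (by simpa using congrArg (· * g) h)
  obtain ⟨n, hn⟩ := SkewSectionPrime.two_mul_prime_dvd_card c u 2 hcc hu2 hu1 (hcen u)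
    (SkewSectionPrime.ne_pow_of_nonnormal hc1 hcen hu2 hu1 hnn)
  exact exists_simple_degenerate_of_nonnormal_prime_order e u 2 n hu2 hu1 hn hnn
    (SkewSectionPrime.count_two n (by omega))

/-- **`p = 2` at order `48`: an involution with at least THREE conjugates** (`g₁⁻¹ u g₁ ≠ u`, `g₂⁻¹ u g₂ ≠ u`,
`(g₂⁻¹g₁) u (g₂⁻¹g₁)⁻¹ ≠ u`) ⟹ a simple DEGENERATE abelian `24`-fold with CM by `K` (family count `count_two_twelve`; at order `48`
two conjugates are not enough for the count).  Rows: `GL(2,3)`, `A₄ × C₄`, `SL(2,3)∘C₄`, `S₄ × C₂`, `D₄₈`, ….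
[cite: Shimura1998, §6.2 Thm. 3, §8.2 Prop. 26 and §32.10] [cite: Gordon1999HodgeAVSurvey, Thm. 6.4 and §9.3] -/
theorem exists_simple_degenerate_of_involution_three_conjugates {G₀ : Type*} [Group G₀] [Fintype G₀] [DecidableEq G₀]
    (e : (K ≃ₐ[ℚ] K) ≃* G₀) (u g₁ g₂ : G₀) (huu : u * u = 1) (h1 : g₁⁻¹ * u * g₁ ≠ u) (h2 : g₂⁻¹ * u * g₂ ≠ u)
    (h12 : g₂⁻¹ * g₁ * u * (g₂⁻¹ * g₁)⁻¹ ≠ u) (hcard : Fintype.card G₀ = 48) :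
    ∃ (Φ : CMType K) (φ₀ : K →+* ℂ) (A : AbelianVariety ℂ) (ι : 𝓞 K →+* End A)
      (θ : K →+* Module.End ℂ (complexBetti A.X 1)),
      IsPrimitive (ℂ ≃+* ℂ) Φ.1 φ₀ ∧ ¬ IsNondegenerate Φ ∧ IsCMTypeRealisation Φ A ι θ ∧ A.IsSimple ∧ A.dim = 24 ∧
      ∃ n p : ℕ, ∃ x : complexBetti (⨁ fun _ : Fin n => A).X (2 * p), IsRationalClass x ∧
        IsOfHodgeType (⨁ fun _ : Fin n => A).dim (⨁ fun _ : Fin n => A).X (2 * p) p p x ∧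
        x ∉ divisorClassesSpan (⨁ fun _ : Fin n => A).X (⨁ fun _ : Fin n => A).dim p := by
  classical
  set c := e ((IsCMField.complexConj K).restrictScalars ℚ) with hc_def
  have hc1 : c ≠ 1 := model_complexConj_ne_one e rfl
  have hcen : ∀ g : G₀, c * g = g * c := model_complexConj_comm e rfl
  have hu1 : u ≠ 1 := fun h => h1 (by rw [h, mul_one, inv_mul_cancel])
  have hu2 : u ^ 2 = 1 := by rw [pow_two, huu]
  have hconj1 : ∀ x : G₀, x * u * x⁻¹ ≠ 1 := fun x h => hu1 (by
    have := congrArg (fun y => x⁻¹ * y * x) h; simpa [mul_assoc] using this)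
  have hcU : ∀ j < 2, c ≠ u ^ j := by
    intro j hj
    interval_cases j
    · rw [pow_zero]; exact hc1
    · rw [pow_one]; intro h; apply h1; rw [← h, mul_assoc, hcen, ← mul_assoc, inv_mul_cancel, one_mul]
  obtain ⟨Φ, φ₀, A, ι, θ, H1, H2, H3, H4, H5, H6⟩ := exists_simple_degenerate_of_prime_order_family e u 2 12 3 hu2 hu1
    hcU (by rw [hcard]) (fun i => if (i : ℕ) = 0 then 1 else if (i : ℕ) = 1 then g₁ else g₂) (by
      intro i j hij k hk
      have hk' : k = 0 ∨ k = 1 := by omega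
      have hinv : (g₂⁻¹ * g₁)⁻¹ = g₁⁻¹ * g₂ := by rw [mul_inv_rev, inv_inv]
      fin_cases i <;> fin_cases j <;> simp at hij ⊢ <;> rcases hk' with rfl | rfl <;> simp only [pow_zero, pow_one]
      · simpa using hconj1 g₁⁻¹
      · simpa using h1
      · simpa using hconj1 g₂⁻¹
      · simpa using h2
      · rw [← hinv]; exact hconj1 _
      · rw [← hinv]; exact h12) SkewSectionPrime.count_two_twelve
  exact ⟨Φ, φ₀, A, ι, θ, H1, H2, H3, H4, by rw [H5, hcard], H6⟩

/-- **… on `Gal(K/ℚ)` itself**: `[K:ℚ] = 2pn`, `16 ≤ n`, `8p ≤ 2^(n/4)`, and `σ ∈ Gal(K/ℚ)` with `σᵖ = 1 ≠ σ` whose subgroup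
`⟨σ⟩` is NOT normal ⟹ `K` carries a SIMPLE DEGENERATE abelian variety of dimension `[K:ℚ]/2` with CM by `K`.
[cite: Shimura1998, §6.2 Thm. 3, §8.2 Prop. 26 and §32.10] [cite: Gordon1999HodgeAVSurvey, Thm. 6.4 and §9.3] -/
theorem exists_simple_degenerate_of_nonnormal_prime_order_gal (σ : K ≃ₐ[ℚ] K) (p n : ℕ) [hp : Fact p.Prime]
    (hσp : σ ^ p = 1) (hσ1 : σ ≠ 1) (hnn : ∃ τ : K ≃ₐ[ℚ] K, ∀ k < p, τ * σ * τ⁻¹ ≠ σ ^ k)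
    (hdeg : Module.finrank ℚ K = 2 * p * n) (hn : 16 ≤ n) (hpn : 8 * p ≤ 2 ^ (n / 4)) :
    ∃ (Φ : CMType K) (φ₀ : K →+* ℂ) (A : AbelianVariety ℂ) (ι : 𝓞 K →+* End A)
      (θ : K →+* Module.End ℂ (complexBetti A.X 1)),
      IsPrimitive (ℂ ≃+* ℂ) Φ.1 φ₀ ∧ ¬ IsNondegenerate Φ ∧ IsCMTypeRealisation Φ A ι θ ∧ A.IsSimple ∧
      A.dim = Module.finrank ℚ K / 2 ∧
      ∃ n p : ℕ, ∃ x : complexBetti (⨁ fun _ : Fin n => A).X (2 * p), IsRationalClass x ∧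
        IsOfHodgeType (⨁ fun _ : Fin n => A).dim (⨁ fun _ : Fin n => A).X (2 * p) p p x ∧
        x ∉ divisorClassesSpan (⨁ fun _ : Fin n => A).X (⨁ fun _ : Fin n => A).dim p := by
  classical
  have hcard : Fintype.card (K ≃ₐ[ℚ] K) = 2 * p * n := by
    rw [card_model_eq_finrank (MulEquiv.refl (K ≃ₐ[ℚ] K))]; exact hdeg
  obtain ⟨Φ, φ₀, A, ι, θ, H1, H2, H3, H4, H5, H6⟩ :=
    exists_simple_degenerate_of_nonnormal_prime_order_of_le (MulEquiv.refl (K ≃ₐ[ℚ] K)) σ p n hσp hσ1 hcard hnn hn hpn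
  refine ⟨Φ, φ₀, A, ι, θ, H1, H2, H3, H4, ?_, H6⟩
  rw [H5, card_model_eq_finrank (MulEquiv.refl (K ≃ₐ[ℚ] K))]

/-- **… on `Gal(K/ℚ)` itself, `p = 3`**: `[K:ℚ] ≥ 84` and `σ` of order `3` with `⟨σ⟩` NOT normal ⟹ `K` carries a SIMPLE
DEGENERATE abelian variety of dimension `[K:ℚ]/2` with CM by `K`.
[cite: Shimura1998, §6.2 Thm. 3, §8.2 Prop. 26 and §32.10] [cite: Gordon1999HodgeAVSurvey, Thm. 6.4 and §9.3] -/
theorem exists_simple_degenerate_of_nonnormal_order_three_gal (σ : K ≃ₐ[ℚ] K) (hσ3 : σ ^ 3 = 1) (hσ1 : σ ≠ 1)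
    (hnn : ∃ τ : K ≃ₐ[ℚ] K, ∀ k < 3, τ * σ * τ⁻¹ ≠ σ ^ k) (hdeg : 84 ≤ Module.finrank ℚ K) :
    ∃ (Φ : CMType K) (φ₀ : K →+* ℂ) (A : AbelianVariety ℂ) (ι : 𝓞 K →+* End A)
      (θ : K →+* Module.End ℂ (complexBetti A.X 1)),
      IsPrimitive (ℂ ≃+* ℂ) Φ.1 φ₀ ∧ ¬ IsNondegenerate Φ ∧ IsCMTypeRealisation Φ A ι θ ∧ A.IsSimple ∧
      A.dim = Module.finrank ℚ K / 2 ∧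
      ∃ n p : ℕ, ∃ x : complexBetti (⨁ fun _ : Fin n => A).X (2 * p), IsRationalClass x ∧
        IsOfHodgeType (⨁ fun _ : Fin n => A).dim (⨁ fun _ : Fin n => A).X (2 * p) p p x ∧
        x ∉ divisorClassesSpan (⨁ fun _ : Fin n => A).X (⨁ fun _ : Fin n => A).dim p := by
  classical
  have hbig : 84 ≤ Fintype.card (K ≃ₐ[ℚ] K) := by rw [card_model_eq_finrank (MulEquiv.refl (K ≃ₐ[ℚ] K))]; exact hdeg
  obtain ⟨Φ, φ₀, A, ι, θ, H1, H2, H3, H4, H5, H6⟩ :=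
    exists_simple_degenerate_of_nonnormal_order_three (MulEquiv.refl (K ≃ₐ[ℚ] K)) σ hσ3 hσ1 hnn hbig
  refine ⟨Φ, φ₀, A, ι, θ, H1, H2, H3, H4, ?_, H6⟩
  rw [H5, card_model_eq_finrank (MulEquiv.refl (K ≃ₐ[ℚ] K))]

/-- **GOOD Galois CM fields have every prime-order subgroup of the Galois group NORMAL** (`[K:ℚ] = 2pn`, `16 ≤ n`,
`8p ≤ 2^(n/4)`): if every primitive CM type of `K` is nondegenerate, then for every `σ ∈ Gal(K/ℚ)` with `σᵖ = 1 ≠ σ` and every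
`τ`, `τ σ τ⁻¹` is a power of `σ`. [cite: Shimura1998, §8.2 Prop. 26 and §32.10] -/
theorem exists_conj_eq_pow_of_forall_isNondegenerate (p n : ℕ) [Fact p.Prime] (hdeg : Module.finrank ℚ K = 2 * p * n)
    (hn : 16 ≤ n) (hpn : 8 * p ≤ 2 ^ (n / 4))
    (hgood : ∀ (Φ : CMType K) (φ : K →+* ℂ), IsPrimitive (ℂ ≃+* ℂ) Φ.1 φ → IsNondegenerate Φ)
    (σ : K ≃ₐ[ℚ] K) (hσp : σ ^ p = 1) (hσ1 : σ ≠ 1) (τ : K ≃ₐ[ℚ] K) : ∃ k < p, τ * σ * τ⁻¹ = σ ^ k := by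
  by_contra h
  push Not at h
  obtain ⟨Φ, φ₀, A, ι, θ, H1, H2, -⟩ :=
    exists_simple_degenerate_of_nonnormal_prime_order_gal σ p n hσp hσ1 ⟨τ, h⟩ hdeg hn hpn
  exact H2 (hgood Φ φ₀ H1)

/-- **GOOD Galois CM fields of degree `≥ 84` have every subgroup of order `3` of the Galois group NORMAL**: if every primitive
CM type of `K` is nondegenerate, then for `σ` of order `3` and every `τ`, `τ σ τ⁻¹ ∈ {1, σ, σ²}`.
[cite: Shimura1998, §8.2 Prop. 26 and §32.10] -/
theorem exists_conj_eq_pow_three_of_forall_isNondegenerate (hdeg : 84 ≤ Module.finrank ℚ K)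
    (hgood : ∀ (Φ : CMType K) (φ : K →+* ℂ), IsPrimitive (ℂ ≃+* ℂ) Φ.1 φ → IsNondegenerate Φ)
    (σ : K ≃ₐ[ℚ] K) (hσ3 : σ ^ 3 = 1) (hσ1 : σ ≠ 1) (τ : K ≃ₐ[ℚ] K) : ∃ k < 3, τ * σ * τ⁻¹ = σ ^ k := by
  by_contra h
  push Not at h
  obtain ⟨Φ, φ₀, A, ι, θ, H1, H2, -⟩ := exists_simple_degenerate_of_nonnormal_order_three_gal σ hσ3 hσ1 ⟨τ, h⟩ hdeg
  exact H2 (hgood Φ φ₀ H1)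

/-- **In a GOOD Galois CM field, elements of prime order `p` of the Galois group COMMUTE pairwise** (`[K:ℚ] = 2pn`, `16 ≤ n`,
`8p ≤ 2^(n/4)`): the subgroups of order `p` are normal, and two such normalise each other only by commuting
(`SkewSectionPrime.commute_of_conj_eq_pow`).  So the elements of order `p` generate an elementary abelian normal `p`-subgroup all of
whose subgroups are normal in `Gal(K/ℚ)`. [cite: Shimura1998, §8.2 Prop. 26 and §32.10] -/
theorem commute_of_prime_order_of_forall_isNondegenerate (p n : ℕ) [Fact p.Prime] (hdeg : Module.finrank ℚ K = 2 * p * n)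
    (hn : 16 ≤ n) (hpn : 8 * p ≤ 2 ^ (n / 4))
    (hgood : ∀ (Φ : CMType K) (φ : K →+* ℂ), IsPrimitive (ℂ ≃+* ℂ) Φ.1 φ → IsNondegenerate Φ)
    (σ τ : K ≃ₐ[ℚ] K) (hσp : σ ^ p = 1) (hτp : τ ^ p = 1) : σ * τ = τ * σ := by
  classical
  by_cases hσ1 : σ = 1
  · rw [hσ1, one_mul, mul_one]
  by_cases hτ1 : τ = 1
  · rw [hτ1, one_mul, mul_one]
  obtain ⟨k, -, hk⟩ := exists_conj_eq_pow_of_forall_isNondegenerate p n hdeg hn hpn hgood σ hσp hσ1 τ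
  obtain ⟨l, -, hl⟩ := exists_conj_eq_pow_of_forall_isNondegenerate p n hdeg hn hpn hgood τ hτp hτ1 σ
  exact SkewSectionPrime.commute_of_conj_eq_pow hσp hτp ⟨k, hk⟩ ⟨l, hl⟩

/-- **… elements of two DIFFERENT prime orders `p`, `q` commute as well** (size conditions for both primes).
[cite: Shimura1998, §8.2 Prop. 26 and §32.10] -/
theorem commute_of_prime_orders_of_forall_isNondegenerate (p n q n' : ℕ) [Fact p.Prime] [Fact q.Prime]
    (hdeg : Module.finrank ℚ K = 2 * p * n) (hn : 16 ≤ n) (hpn : 8 * p ≤ 2 ^ (n / 4))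
    (hdeg' : Module.finrank ℚ K = 2 * q * n') (hn' : 16 ≤ n') (hqn : 8 * q ≤ 2 ^ (n' / 4))
    (hgood : ∀ (Φ : CMType K) (φ : K →+* ℂ), IsPrimitive (ℂ ≃+* ℂ) Φ.1 φ → IsNondegenerate Φ)
    (σ τ : K ≃ₐ[ℚ] K) (hσp : σ ^ p = 1) (hτq : τ ^ q = 1) : σ * τ = τ * σ := by
  classical
  by_cases hσ1 : σ = 1
  · rw [hσ1, one_mul, mul_one]
  by_cases hτ1 : τ = 1
  · rw [hτ1, one_mul, mul_one]
  obtain ⟨k, -, hk⟩ := exists_conj_eq_pow_of_forall_isNondegenerate p n hdeg hn hpn hgood σ hσp hσ1 τ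
  obtain ⟨l, -, hl⟩ := exists_conj_eq_pow_of_forall_isNondegenerate q n' hdeg' hn' hqn hgood τ hτq hτ1 σ
  exact SkewSectionPrime.commute_of_conj_eq_pow hσp hτq ⟨k, hk⟩ ⟨l, hl⟩

/-- **In a GOOD Galois CM field of degree `≥ 84`, any two elements of order `3` of the Galois group commute** — the `3`-torsion
of `Gal(K/ℚ)` generates an elementary abelian normal `3`-subgroup with all its subgroups normal.
[cite: Shimura1998, §8.2 Prop. 26 and §32.10] -/
theorem commute_of_order_three_of_forall_isNondegenerate (hdeg : 84 ≤ Module.finrank ℚ K)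
    (hgood : ∀ (Φ : CMType K) (φ : K →+* ℂ), IsPrimitive (ℂ ≃+* ℂ) Φ.1 φ → IsNondegenerate Φ)
    (σ τ : K ≃ₐ[ℚ] K) (hσ3 : σ ^ 3 = 1) (hτ3 : τ ^ 3 = 1) : σ * τ = τ * σ := by
  classical
  haveI : Fact (Nat.Prime 3) := ⟨Nat.prime_three⟩
  by_cases hσ1 : σ = 1
  · rw [hσ1, one_mul, mul_one]
  by_cases hτ1 : τ = 1
  · rw [hτ1, one_mul, mul_one]
  obtain ⟨k, -, hk⟩ := exists_conj_eq_pow_three_of_forall_isNondegenerate hdeg hgood σ hσ3 hσ1 τ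
  obtain ⟨l, -, hl⟩ := exists_conj_eq_pow_three_of_forall_isNondegenerate hdeg hgood τ hτ3 hτ1 σ
  exact SkewSectionPrime.commute_of_conj_eq_pow hσ3 hτ3 ⟨k, hk⟩ ⟨l, hl⟩

/-- **GOOD Galois CM fields of degree `≥ 52` have all involutions of the Galois group central** (gen 32:
`commute_of_involution_of_forall_isNondegenerate` from degree `64`). [cite: Shimura1998, §8.2 Prop. 26 and §32.10] -/
theorem commute_of_involution_of_forall_isNondegenerate_of_le (hdeg : 52 ≤ Module.finrank ℚ K)
    (hgood : ∀ (Φ : CMType K) (φ : K →+* ℂ), IsPrimitive (ℂ ≃+* ℂ) Φ.1 φ → IsNondegenerate Φ)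
    (σ : K ≃ₐ[ℚ] K) (hσ : σ * σ = 1) (τ : K ≃ₐ[ℚ] K) : τ * σ = σ * τ := by
  classical
  by_contra h
  have hbig : 52 ≤ Fintype.card (K ≃ₐ[ℚ] K) := by rw [card_model_eq_finrank (MulEquiv.refl (K ≃ₐ[ℚ] K))]; exact hdeg
  obtain ⟨Φ, φ₀, A, ι, θ, H1, H2, -⟩ :=
    exists_simple_degenerate_of_noncentral_involution_of_card_ge (MulEquiv.refl (K ≃ₐ[ℚ] K)) σ hσ ⟨τ, h⟩ hbig
  exact H2 (hgood Φ φ₀ H1)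

end Summit.HodgeConjecture.CorCM.GaloisModels

end
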